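import Mathlib.Analysis.SpecialFunctions.Exp
import HarnessLib

/-!
# K1L_D (stmt-AnomalousDissipation-27980), stub S23″: composing modal tracking over two ALIGNED sub-windows (S3′ brick §M)
# (helper; `--supports … --as helper`)

The last genuine window of the ledger's grid `gridL` has length in `[r, 2r)` and spans two insertion windows of level `m+1`; the assembly composes the
per-window modal tracking of the two aligned pieces at the MODE level (lead's implementation note 17:32Z / S3core-plan §M): if over piece 1 the
tracked amplitude satisfies `|a₁ − e^{−rτ₁}σ| ≤ ε₁·min(1, rτ₁)·σ` and over piece 2 (restarted description, from the state `a₁`)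
`|a₂ − e^{−rτ₂}a₁| ≤ (ε₂·min(1, rτ₂) + b)·|a₁|` with a burst `b ≤ β·min(1, r(τ₁+τ₂))`, then over the merged window
`|a₂ − e^{−r(τ₁+τ₂)}σ| ≤ (ε₁ + 2ε₂ + 2β)·min(1, r(τ₁+τ₂))·σ` — still dissipation-dominated against the merged decay weight.  Pure real algebra.
Infrastructure for rung F-D1.A0; NOT a proof of the crux or of anomalous dissipation.
-/

set_option linter.dupNamespace false

namespace Summit.AnomalousDissipation.AnomalousDissipation.Theorems.SolenoidalFractalHomogenisation.LagrangianStep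

/-- The decay weight `min(1, r τ)` is monotone in the window length. -/
theorem decayWeight_mono {r τ τ' : ℝ} (hr : 0 ≤ r) (h : τ ≤ τ') : min 1 (r * τ) ≤ min 1 (r * τ') :=
  min_le_min le_rfl (mul_le_mul_of_nonneg_left h hr)

/-- **Two-piece composition of modal tracking.**  See the module docstring. -/
theorem track_compose {r τ₁ τ₂ σ a₁ a₂ ε₁ ε₂ b β : ℝ} (hr : 0 ≤ r) (hτ₁ : 0 ≤ τ₁) (hτ₂ : 0 ≤ τ₂) (hσ : 0 ≤ σ)
    (hε₁ : 0 ≤ ε₁) (hε₁1 : ε₁ ≤ 1) (hε₂ : 0 ≤ ε₂) (hb : 0 ≤ b) (hbβ : b ≤ β * min 1 (r * (τ₁ + τ₂)))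
    (h₁ : |a₁ - Real.exp (-(r * τ₁)) * σ| ≤ ε₁ * min 1 (r * τ₁) * σ)
    (h₂ : |a₂ - Real.exp (-(r * τ₂)) * a₁| ≤ (ε₂ * min 1 (r * τ₂) + b) * |a₁|) :
    |a₂ - Real.exp (-(r * (τ₁ + τ₂))) * σ| ≤ (ε₁ + 2 * ε₂ + 2 * β) * min 1 (r * (τ₁ + τ₂)) * σ := by
  set d₁ := min 1 (r * τ₁) with hd₁
  set d₂ := min 1 (r * τ₂) with hd₂
  set d := min 1 (r * (τ₁ + τ₂)) with hd
  have hd₁0 : 0 ≤ d₁ := le_min zero_le_one (mul_nonneg hr hτ₁)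
  have hd₂0 : 0 ≤ d₂ := le_min zero_le_one (mul_nonneg hr hτ₂)
  have hd0 : 0 ≤ d := le_min zero_le_one (mul_nonneg hr (by linarith))
  have hd₁d : d₁ ≤ d := decayWeight_mono hr (by linarith)
  have hd₂d : d₂ ≤ d := decayWeight_mono hr (by linarith)
  have hd11 : d₁ ≤ 1 := min_le_left _ _
  set l₁ := Real.exp (-(r * τ₁)) with hl₁
  set l₂ := Real.exp (-(r * τ₂)) with hl₂
  have hl₁0 : 0 < l₁ := Real.exp_pos _
  have hl₂0 : 0 < l₂ := Real.exp_pos _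
  have hl₁1 : l₁ ≤ 1 := by rw [hl₁, Real.exp_le_one_iff]; exact neg_nonpos.2 (mul_nonneg hr hτ₁)
  have hl₂1 : l₂ ≤ 1 := by rw [hl₂, Real.exp_le_one_iff]; exact neg_nonpos.2 (mul_nonneg hr hτ₂)
  have hl : Real.exp (-(r * (τ₁ + τ₂))) = l₂ * l₁ := by
    rw [hl₁, hl₂, ← Real.exp_add]; congr 1; ring
  -- `|a₁| ≤ (l₁ + ε₁ d₁) σ ≤ 2σ`
  have ha₁ : |a₁| ≤ (l₁ + ε₁ * d₁) * σ := by
    have := abs_sub_abs_le_abs_sub a₁ (l₁ * σ)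
    rw [abs_of_nonneg (mul_nonneg hl₁0.le hσ)] at this
    linarith
  have ha₁' : |a₁| ≤ 2 * σ := by
    have : (l₁ + ε₁ * d₁) ≤ 2 := by nlinarith
    exact ha₁.trans (mul_le_mul_of_nonneg_right this hσ)
  -- triangle: `|a₂ − l₂ l₁ σ| ≤ |a₂ − l₂ a₁| + l₂ |a₁ − l₁ σ|`
  have htri : |a₂ - l₂ * l₁ * σ| ≤ |a₂ - l₂ * a₁| + l₂ * |a₁ - l₁ * σ| := by
    have h3 : a₂ - l₂ * l₁ * σ = (a₂ - l₂ * a₁) + l₂ * (a₁ - l₁ * σ) := by ring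
    rw [h3]
    calc |a₂ - l₂ * a₁ + l₂ * (a₁ - l₁ * σ)| ≤ |a₂ - l₂ * a₁| + |l₂ * (a₁ - l₁ * σ)| := abs_add_le _ _
      _ = |a₂ - l₂ * a₁| + l₂ * |a₁ - l₁ * σ| := by rw [abs_mul, abs_of_pos hl₂0]
  rw [hl]
  -- piece 2 against `|a₁| ≤ 2σ`, piece 1 against `l₂ ≤ 1`
  have hp2 : |a₂ - l₂ * a₁| ≤ (ε₂ * d₂ + b) * (2 * σ) :=
    h₂.trans (mul_le_mul_of_nonneg_left ha₁' (by positivity))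
  have hp1 : l₂ * |a₁ - l₁ * σ| ≤ ε₁ * d₁ * σ :=
    (mul_le_mul_of_nonneg_left h₁ hl₂0.le).trans (by nlinarith [mul_nonneg (mul_nonneg hε₁ hd₁0) hσ])
  -- collect with `d₁, d₂ ≤ d`, `b ≤ β d`
  have hε₁d : ε₁ * d₁ * σ ≤ ε₁ * d * σ := by gcongr
  have hε₂d : ε₂ * d₂ ≤ ε₂ * d := mul_le_mul_of_nonneg_left hd₂d hε₂
  calc |a₂ - l₂ * l₁ * σ| ≤ |a₂ - l₂ * a₁| + l₂ * |a₁ - l₁ * σ| := htri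
    _ ≤ (ε₂ * d₂ + b) * (2 * σ) + ε₁ * d₁ * σ := add_le_add hp2 hp1
    _ ≤ (ε₂ * d + β * d) * (2 * σ) + ε₁ * d * σ := by
        have : (ε₂ * d₂ + b) ≤ (ε₂ * d + β * d) := by linarith
        nlinarith [mul_le_mul_of_nonneg_right this (by positivity : (0:ℝ) ≤ 2 * σ)]
    _ = (ε₁ + 2 * ε₂ + 2 * β) * d * σ := by ring

end Summit.AnomalousDissipation.AnomalousDissipation.Theorems.SolenoidalFractalHomogenisation.LagrangianStep
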